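import Literature.AlgebraicGeometry.Motives.CartierDivisorExtension
import Literature.AlgebraicGeometry.Motives.CartierDivisorClassPullback
import Literature.AlgebraicGeometry.Motives.MorphismsToProjectiveSpace
import Literature.AlgebraicGeometry.Motives.ProjectiveSpaceFieldPointsBijective
import HarnessLib

/-!
# Rational maps to projective space from a vector of rational functions (linear systems)

Topic: `Literature/AlgebraicGeometry/Resolution`. Let `X` be an integral scheme over a ring `k`
with function field `K(X)` and `z = (z₀, …, zₙ) ∈ K(X)ⁿ⁺¹`. Classically (Hartshorne II.7.1 and
II Ex. 7.? for varieties; Görtz–Wedhorn I, (9.3) and §13.16; Zariski's "linear system cut out by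
`z`"), `z` defines a rational map `X ⋯→ ℙⁿ_k`, `x ↦ (z₀(x) : … : zₙ(x))`, DEFINED at `x` as soon as
for some `i` with `zᵢ ≠ 0` all ratios `z_l / zᵢ` lie in `𝒪_{X,x}` (equivalently: the fractional
ideal `∑ 𝒪_{X,x} z_l` is principal). This file constructs the morphism on the locus of definition
by instantiating the tree's `Motives.GeneratingSections` (Hartshorne's proof of II Thm. 7.1 from
charts and ratios, `Motives/MorphismsToProjectiveSpace`). Everything here is PROVED:

* `lsChart z i : X.Opens` — the `i`-th chart `{x | zᵢ ≠ 0, z_l/zᵢ ∈ 𝒪_{X,x} ∀ l}` of the linear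
  system (open: tree `Motives.RatFn.isOpen_setOf_isRegularAt`, `Motives/CartierDivisor`),
  `IsDefinedAt z x` — some chart contains `x` — and `lsRatio z i j ∈ Γ(lsChart z i, 𝒪_X)`, THE
  section with generic value `z_j/zᵢ` (tree `Motives.RatFn.sectionOf`, i.e.
  `𝒪_X(V) = ⋂ 𝒪_{X,x}`, `Motives/CartierDivisorExtension`);
* `linearSystem z hdef : Motives.GeneratingSections (Fin (n+1)) X` when `z` is defined everywhere
  (`hdef`): the cocycle `(z_j/zᵢ)(z_l/z_j) = z_l/zᵢ` and `X_{z_j/zᵢ} = Uᵢ ∩ U_j` are checked in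
  `K(X)`;
* `toProjOfVec z f hdef : X ⟶ Proj k[x₀,…,xₙ]` over `f : X → Spec k` (`toProjOfVec_toSpec`), with
  `toProjOfVec ⁻¹ D₊(x_j) = lsChart z j` (`toProjOfVec_preimage_basicOpen`) and the chart
  description `comp_toProjOfVec` of `g ≫ toProjOfVec` for any `g : T → X` landing in a chart;
* over a field `k`: `comp_toProjOfVec_eq_chartPoint` — an `L`-valued point `κ` of `X` over `k`
  landing in the `i`-th chart is mapped to the point of `ℙⁿ_k` with homogeneous coordinates
  `((z₀/zᵢ)(κ) : … : (zₙ/zᵢ)(κ))` (tree `Motives.ProjectiveSpace.chartPoint`; the chart ring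
  map is the evaluation `k`-algebra map, `Motives.ProjectiveSpace.awayEval_coord_eq`), and
  **`fromSpecStalk_genericPoint_toProjOfVec`** — the `K(X)`-point of `toProjOfVec z` is the point
  with homogeneous coordinates `z` (`Motives.ProjectiveSpace.pointOfVec k z`): the morphism is
  the rational map `(z₀ : … : zₙ)`.

The converse (a `k`-morphism to `ℙⁿ_k` with generic point `(z₀ : … : zₙ)` forces `IsDefinedAt z`
everywhere) and the translation into local principality of the ideal sheaf generated by `z` are
left to a sequel.

## References

* R. Hartshorne, *Algebraic Geometry* (1977), II Thm. 7.1 and its proof. [Hartshorne1977]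
* U. Görtz, T. Wedhorn, *Algebraic Geometry I*, 2nd ed. (2020), (9.3), Prop. 9.26.
  [GortzWedhorn2020]
* O. Piltant, RACSAM 107 (2013), §2 (Axiom 4) and Lemma 3.3 (rational maps between projective
  models defined via principal ideals). [Piltant2013]
-/

noncomputable section

open CategoryTheory CategoryTheory.Limits AlgebraicGeometry TopologicalSpace Opposite
open Literature.AlgebraicGeometry.Motives Literature.AlgebraicGeometry.Motives.Segre

attribute [local instance] MvPolynomial.gradedAlgebra

namespace Literature.AlgebraicGeometry.Resolution

universe u

variable {X : Scheme.{u}} [IsIntegral X] {n : ℕ} (z : Fin (n + 1) → X.functionField)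

/-! ## The charts of the linear system -/

/-- The `i`-th **chart of the linear system** of `z ∈ K(X)ⁿ⁺¹`: the open set of points `x` with
`zᵢ ≠ 0` and `z_l / zᵢ ∈ 𝒪_{X,x}` for all `l` (where the rational map `(z₀ : … : zₙ)` is defined
through the chart `D₊(xᵢ)`). [cite: Hartshorne1977, II Thm. 7.1 (proof)] -/
def lsChart (i : Fin (n + 1)) : X.Opens :=
  ⟨{_x | z i ≠ 0} ∩ ⋂ l, {x | RatFn.IsRegularAt x (z l / z i)},
    (isOpen_const).inter (isOpen_iInter_of_finite fun _ => RatFn.isOpen_setOf_isRegularAt _)⟩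

/-- Membership in a chart of the linear system. [folklore] -/
theorem mem_lsChart_iff {i : Fin (n + 1)} {x : X} :
    x ∈ lsChart z i ↔ z i ≠ 0 ∧ ∀ l, RatFn.IsRegularAt x (z l / z i) := by
  show x ∈ ({_x | z i ≠ 0} ∩ ⋂ l, {x | RatFn.IsRegularAt x (z l / z i)}) ↔ _
  simp only [Set.mem_inter_iff, Set.mem_setOf_eq, Set.mem_iInter]

/-- **The rational map `(z₀ : … : zₙ)` is defined at `x`**: `x` lies in some chart of the linear
system. [cite: Hartshorne1977, II Thm. 7.1 (proof)] -/
def IsDefinedAt (x : X) : Prop :=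
  ∃ i, x ∈ lsChart z i

/-- A chart with `zᵢ = 0` is empty. [folklore] -/
theorem lsChart_eq_bot {i : Fin (n + 1)} (hi : z i = 0) : lsChart z i = ⊥ := by
  ext x
  simp only [SetLike.mem_coe, mem_lsChart_iff, Opens.coe_bot, Set.mem_empty_iff_false,
    iff_false, not_and]
  exact fun h => absurd hi h

/-- The generic point lies in every chart with `zᵢ ≠ 0`. [folklore] -/
theorem genericPoint_mem_lsChart {i : Fin (n + 1)} (hi : z i ≠ 0) :
    genericPoint X ∈ lsChart z i :=
  (mem_lsChart_iff z).mpr ⟨hi, fun _ => RatFn.isRegularAt_genericPoint _⟩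

/-- All ratios `z_l/zᵢ` are regular on the `i`-th chart. [folklore] -/
theorem isRegularAt_of_mem_lsChart {i : Fin (n + 1)} {x : X} (hx : x ∈ lsChart z i)
    (l : Fin (n + 1)) : RatFn.IsRegularAt x (z l / z i) :=
  ((mem_lsChart_iff z).mp hx).2 l

/-- `zᵢ ≠ 0` on a non-empty chart. [folklore] -/
theorem ne_zero_of_mem_lsChart {i : Fin (n + 1)} {x : X} (hx : x ∈ lsChart z i) : z i ≠ 0 :=
  ((mem_lsChart_iff z).mp hx).1

/-- Sections over an empty chart form a trivial ring. [folklore] -/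
theorem subsingleton_sections_lsChart {i : Fin (n + 1)} (hi : z i = 0) :
    Subsingleton Γ(X, lsChart z i) :=
  CommRingCat.subsingleton_of_isTerminal (X.sheaf.isTerminalOfEqEmpty (lsChart_eq_bot z hi))

omit [IsIntegral X] in
/-- `Γ(U, 𝒪_X) → K(X)` is injective for `U ∋ ξ` (Mathlib `germ_injective_of_isIntegral`).
[folklore] -/
theorem ofSection_injective [IsIntegral X] {U : X.Opens} (hU : genericPoint X ∈ U) :
    Function.Injective (RatFn.ofSection hU : Γ(X, U) → X.functionField) :=
  germ_injective_of_isIntegral _ _ hU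

omit [IsIntegral X] in
/-- `Γ(U, 𝒪_X) → K(X)` is multiplicative. [folklore] -/
theorem ofSection_mul [IsIntegral X] {U : X.Opens} (hU : genericPoint X ∈ U) (σ τ : Γ(X, U)) :
    RatFn.ofSection hU (σ * τ) = RatFn.ofSection hU σ * RatFn.ofSection hU τ :=
  map_mul (X.presheaf.germ U (genericPoint X) hU).hom σ τ

omit [IsIntegral X] in
/-- `Γ(U, 𝒪_X) → K(X)` maps `1` to `1`. [folklore] -/
theorem ofSection_one [IsIntegral X] {U : X.Opens} (hU : genericPoint X ∈ U) :
    RatFn.ofSection hU (1 : Γ(X, U)) = 1 :=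
  map_one (X.presheaf.germ U (genericPoint X) hU).hom

omit [IsIntegral X] in
/-- `Γ(U, 𝒪_X) → K(X)` maps `0` to `0`. [folklore] -/
theorem ofSection_zero [IsIntegral X] {U : X.Opens} (hU : genericPoint X ∈ U) :
    RatFn.ofSection hU (0 : Γ(X, U)) = 0 :=
  map_zero (X.presheaf.germ U (genericPoint X) hU).hom

/-! ## The ratios `z_j / zᵢ` as sections on the charts -/

/-- The **ratio section** `z_j/zᵢ ∈ Γ(lsChart z i, 𝒪_X)`: the section with generic value
`z_j/zᵢ` (tree `Motives.RatFn.sectionOf`), and `0` on an empty chart.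
[cite: Hartshorne1977, II Thm. 7.1 (proof)] -/
def lsRatio (i j : Fin (n + 1)) : Γ(X, lsChart z i) :=
  haveI := Classical.propDecidable (z i = 0)
  if hi : z i = 0 then 0
  else RatFn.sectionOf (genericPoint_mem_lsChart z hi) (z j / z i)
    (fun _ hx => isRegularAt_of_mem_lsChart z hx j)

/-- On a non-empty chart the ratio section is `RatFn.sectionOf (z_j/zᵢ)`. [folklore] -/
theorem lsRatio_eq {i : Fin (n + 1)} (hi : z i ≠ 0) (j : Fin (n + 1)) :
    lsRatio z i j = RatFn.sectionOf (genericPoint_mem_lsChart z hi) (z j / z i)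
      (fun _ hx => isRegularAt_of_mem_lsChart z hx j) := by
  simp only [lsRatio, hi]
  rfl

/-- The generic value of the ratio section is `z_j/zᵢ`. [folklore] -/
@[simp]
theorem ofSection_lsRatio {i : Fin (n + 1)} (hi : z i ≠ 0) (j : Fin (n + 1)) :
    RatFn.ofSection (genericPoint_mem_lsChart z hi) (lsRatio z i j) = z j / z i := by
  rw [lsRatio_eq z hi]
  exact RatFn.ofSection_sectionOf _ _ _

/-- `zᵢ/zᵢ = 1`. [folklore] -/
theorem lsRatio_self (i : Fin (n + 1)) : lsRatio z i i = 1 := by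
  by_cases hi : z i = 0
  · haveI := subsingleton_sections_lsChart z hi
    exact Subsingleton.elim _ _
  · apply ofSection_injective (genericPoint_mem_lsChart z hi)
    show RatFn.ofSection _ (lsRatio z i i) = RatFn.ofSection _ 1
    rw [ofSection_lsRatio z hi, ofSection_one, div_self hi]

/-- The germ at `x ∈ lsChart z i` of the ratio section maps to `z_j/zᵢ` in `K(X)`. [folklore] -/
theorem toFunctionField_germ_lsRatio {i : Fin (n + 1)} {x : X} (hx : x ∈ lsChart z i)
    (j : Fin (n + 1)) :
    RatFn.toFunctionField x (X.presheaf.germ _ x hx (lsRatio z i j)) = z j / z i := by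
  rw [← RatFn.ofSection_eq_toFunctionField hx, ← ofSection_lsRatio z (ne_zero_of_mem_lsChart z hx) j]

/-- For `x ∈ lsChart z i` and `z_j ≠ 0`: `z_j/zᵢ` is a unit at `x` iff `zᵢ/z_j` is regular at `x`.
[folklore] -/
theorem isUnitAt_div_iff {i j : Fin (n + 1)} {x : X} (hx : x ∈ lsChart z i) (hj : z j ≠ 0) :
    RatFn.IsUnitAt x (z j / z i) ↔ RatFn.IsRegularAt x (z i / z j) := by
  have hi := ne_zero_of_mem_lsChart z hx
  rw [RatFn.isUnitAt_iff, inv_div]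
  exact ⟨fun h => h.2.2, fun h => ⟨div_ne_zero hj hi, isRegularAt_of_mem_lsChart z hx j, h⟩⟩

/-- **`X_{z_j/zᵢ} = Uᵢ ∩ U_j`**: the ratio section `z_j/zᵢ` is invertible at `x ∈ lsChart z i`
exactly when `x ∈ lsChart z j` (then `zᵢ/z_j ∈ 𝒪_{X,x}` and `z_l/z_j = (z_l/zᵢ)(zᵢ/z_j)`).
[cite: Hartshorne1977, II Thm. 7.1 (proof)] -/
theorem basicOpen_lsRatio (i j : Fin (n + 1)) :
    X.basicOpen (lsRatio z i j) = lsChart z i ⊓ lsChart z j := by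
  by_cases hi : z i = 0
  · have h1 : X.basicOpen (lsRatio z i j) = ⊥ :=
      le_bot_iff.mp ((X.basicOpen_le _).trans (lsChart_eq_bot z hi).le)
    rw [h1]
    conv_rhs => rw [lsChart_eq_bot z hi, bot_inf_eq]
  by_cases hj : z j = 0
  · have h0 : lsRatio z i j = 0 := by
      apply ofSection_injective (genericPoint_mem_lsChart z hi)
      show RatFn.ofSection _ (lsRatio z i j) = RatFn.ofSection _ 0
      rw [ofSection_lsRatio z hi, ofSection_zero, hj, zero_div]
    rw [h0, Scheme.basicOpen_zero, lsChart_eq_bot z hj, inf_bot_eq]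
  ext x
  constructor
  · intro hx
    have hxi : x ∈ lsChart z i := X.basicOpen_le _ hx
    refine ⟨hxi, (mem_lsChart_iff z).mpr ⟨hj, fun l => ?_⟩⟩
    have hu : RatFn.IsUnitAt x (z j / z i) := by
      rw [← ofSection_lsRatio z hi j]
      exact (RatFn.isUnitAt_ofSection_iff hxi (lsRatio z i j)).mpr hx
    rw [isUnitAt_div_iff z hxi hj] at hu
    have := (isRegularAt_of_mem_lsChart z hxi l).mul hu
    rwa [div_mul_div_cancel₀ hi] at this
  · rintro ⟨hxi, hxj⟩
    have hu : RatFn.IsUnitAt x (z j / z i) :=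
      (isUnitAt_div_iff z hxi hj).mpr (isRegularAt_of_mem_lsChart z hxj i)
    rw [← ofSection_lsRatio z hi j] at hu
    exact (RatFn.isUnitAt_ofSection_iff hxi (lsRatio z i j)).mp hu

/-- **The cocycle rule** `(z_j/zᵢ) · (z_l/z_j) = z_l/zᵢ` on `Uᵢ ∩ U_j`.
[cite: Hartshorne1977, II Thm. 7.1 (proof)] -/
theorem lsRatio_mul_lsRatio (i j l : Fin (n + 1)) :
    X.presheaf.map (homOfLE inf_le_left).op (lsRatio z i j) *
        X.presheaf.map (homOfLE inf_le_right).op (lsRatio z j l) =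
      X.presheaf.map (homOfLE (inf_le_left : lsChart z i ⊓ lsChart z j ≤ lsChart z i)).op
        (lsRatio z i l) := by
  rcases ((lsChart z i ⊓ lsChart z j : X.Opens) : Set X).eq_empty_or_nonempty with h | h
  · have hbot : lsChart z i ⊓ lsChart z j = ⊥ := SetLike.ext' h
    haveI : Subsingleton Γ(X, lsChart z i ⊓ lsChart z j) :=
      CommRingCat.subsingleton_of_isTerminal (X.sheaf.isTerminalOfEqEmpty hbot)
    exact Subsingleton.elim _ _
  · obtain ⟨x, hxi, hxj⟩ := h
    have hi : z i ≠ 0 := ne_zero_of_mem_lsChart z hxi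
    have hj : z j ≠ 0 := ne_zero_of_mem_lsChart z hxj
    have hξ : genericPoint X ∈ lsChart z i ⊓ lsChart z j :=
      RatFn.genericPoint_mem_of_mem (U := lsChart z i ⊓ lsChart z j) ⟨hxi, hxj⟩
    apply ofSection_injective hξ
    show RatFn.ofSection hξ _ = RatFn.ofSection hξ _
    rw [ofSection_mul, RatFn.ofSection_map, RatFn.ofSection_map, RatFn.ofSection_map,
      ofSection_lsRatio z hi, ofSection_lsRatio z hj, ofSection_lsRatio z hi, mul_comm,
      div_mul_div_cancel₀ hj]

/-! ## The generating-sections datum and the morphism to `ℙⁿ` -/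

/-- **The linear system of `z`** as generating-sections data (the charts `lsChart z i` and the
ratios `z_j/zᵢ`), when the rational map is defined everywhere on `X`.
[cite: Hartshorne1977, II Thm. 7.1 (proof)] -/
def linearSystem (hdef : ∀ x : X, IsDefinedAt z x) : GeneratingSections (Fin (n + 1)) X where
  U := lsChart z
  iSup_U := top_le_iff.mp fun x _ => Opens.mem_iSup.mpr (hdef x)
  ratio := lsRatio z
  ratio_self := lsRatio_self z
  basicOpen_ratio := basicOpen_lsRatio z
  ratio_mul_ratio := lsRatio_mul_lsRatio z

/-- The opens of the linear system are the charts. [folklore] -/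
@[simp]
theorem linearSystem_U (hdef : ∀ x : X, IsDefinedAt z x) (i : Fin (n + 1)) :
    (linearSystem z hdef).U i = lsChart z i := rfl

/-- The ratios of the linear system are the ratio sections. [folklore] -/
@[simp]
theorem linearSystem_ratio (hdef : ∀ x : X, IsDefinedAt z x) (i j : Fin (n + 1)) :
    (linearSystem z hdef).ratio i j = lsRatio z i j := rfl

variable {k : Type u} [CommRing k] (f : X ⟶ Spec (.of k))

/-- **The morphism `X → ℙⁿ_k = Proj k[x₀, …, xₙ]` defined by the vector of rational functions
`z`** on a scheme where the rational map `(z₀ : … : zₙ)` is everywhere defined (Hartshorne II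
Thm. 7.1 (b) applied to the linear system of `z`). [cite: Hartshorne1977, II Thm. 7.1 (b)] -/
def toProjOfVec (hdef : ∀ x : X, IsDefinedAt z x) : X ⟶ Proj (grading (Fin (n + 1)) k) :=
  (linearSystem z hdef).toProj f

/-- `toProjOfVec` is a morphism over `Spec k`. [cite: Hartshorne1977, II Thm. 7.1 (b)] -/
@[reassoc]
theorem toProjOfVec_toSpec (hdef : ∀ x : X, IsDefinedAt z x) :
    toProjOfVec z f hdef ≫ toSpec (Fin (n + 1)) k = f :=
  (linearSystem z hdef).toProj_toSpec f

/-- **`toProjOfVec ⁻¹ D₊(x_j)` is the `j`-th chart of the linear system.**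
[cite: Hartshorne1977, II Thm. 7.1 (b)] -/
theorem toProjOfVec_preimage_basicOpen (hdef : ∀ x : X, IsDefinedAt z x) (j : Fin (n + 1)) :
    toProjOfVec z f hdef ⁻¹ᵁ Proj.basicOpen (grading (Fin (n + 1)) k) (MvPolynomial.X j) =
      lsChart z j :=
  (linearSystem z hdef).toProj_preimage_basicOpen f j

/-- **Chart description**: for `g : T → X` landing in the `i`-th chart, `g ≫ toProjOfVec` is
`T → D₊(xᵢ)` given by the ring map `x_j/xᵢ ↦ g^*(z_j/zᵢ)` (`GeneratingSections.chartMap`).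
[cite: Hartshorne1977, II Thm. 7.1 (proof)] -/
theorem comp_toProjOfVec (hdef : ∀ x : X, IsDefinedAt z x) {T : Scheme.{u}} (g : T ⟶ X)
    {i : Fin (n + 1)} (hg : ⊤ ≤ g ⁻¹ᵁ lsChart z i) :
    g ≫ toProjOfVec z f hdef = (linearSystem z hdef).chartMap f i g hg :=
  (linearSystem z hdef).comp_toProj f g hg


/-! ## Field-valued points: homogeneous coordinates of the image -/

section Points

open MvPolynomial HomogeneousLocalization

attribute [local instance] ProjBaseChange.algebraBase

variable {k : Type u} [Field k] (f : X ⟶ Spec (.of k)) (hdef : ∀ x : X, IsDefinedAt z x)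

omit [IsIntegral X] in
/-- The value at an `R`-valued point `κ : Spec R → X` of a section over an open containing the
image: `Γ(X, V) → Γ(Spec R, 𝒪) ≅ R`. [folklore] -/
def evalAt {R : CommRingCat.{u}} (κ : Spec R ⟶ X) (V : X.Opens) (hV : ⊤ ≤ κ ⁻¹ᵁ V)
    (s : Γ(X, V)) : R :=
  (Scheme.ΓSpecIso R).hom (GeneratingSections.res κ V hV s)

/-- Segre's coordinate fraction `frac k i j = x_j/x_i` is the `coord i j` of
`Motives/ProjectiveSpaceFieldPointsBijective`. [folklore] -/
theorem frac_eq_coord (i j : Fin (n + 1)) :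
    frac k i j = ProjectiveSpace.coord (k := k) i j := by
  apply val_injective
  rw [val_frac, ProjectiveSpace.coord, Away.val_mk, pow_one]

variable {L : Type u} [Field L] [Algebra k L] (κ : Spec (.of L) ⟶ X)

/-- The chart ring map `k[x]_{(xᵢ)} → Γ(Spec L, 𝒪) ≅ L` at an `L`-point over `k` is a `k`-algebra
map. [folklore] -/
def chartAlgHom (hκf : κ ≫ f = Spec.map (CommRingCat.ofHom (algebraMap k L)))
    {i : Fin (n + 1)} (hκ : ⊤ ≤ κ ⁻¹ᵁ lsChart z i) :
    Away (grading (Fin (n + 1)) k) (MvPolynomial.X i) →ₐ[k] L where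
  __ := (Scheme.ΓSpecIso (.of L)).hom.hom.comp ((linearSystem z hdef).chartRingHom f i κ hκ)
  commutes' c := by
    simp only [RingHom.toMonoidHom_eq_coe, OneHom.toFun_eq_coe, MonoidHom.toOneHom_coe,
      MonoidHom.coe_coe, RingHom.coe_comp, Function.comp_apply]
    have h1 : (linearSystem z hdef).chartRingHom f i κ hκ (algebraMap k _ c) = pull (κ ≫ f) c := by
      have := congrArg (fun φ => φ c) ((linearSystem z hdef).chartRingHom_comp_cst f i κ hκ)
      exact this
    rw [h1, hκf, pull_apply]
    rw [← CommRingCat.comp_apply, ← CommRingCat.comp_apply, Scheme.ΓSpecIso_naturality,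
      Iso.inv_hom_id_assoc]
    rfl

/-- The chart algebra map on `x_j/xᵢ` is the value of the ratio section `z_j/zᵢ` at `κ`.
[folklore] -/
theorem chartAlgHom_coord (hκf : κ ≫ f = Spec.map (CommRingCat.ofHom (algebraMap k L)))
    {i : Fin (n + 1)} (hκ : ⊤ ≤ κ ⁻¹ᵁ lsChart z i) (j : Fin (n + 1)) :
    chartAlgHom z f hdef κ hκf hκ (ProjectiveSpace.coord i j) =
      evalAt κ (lsChart z i) hκ (lsRatio z i j) := by
  rw [← frac_eq_coord]
  show (Scheme.ΓSpecIso (.of L)).hom ((linearSystem z hdef).chartRingHom f i κ hκ (frac k i j)) = _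
  rw [GeneratingSections.chartRingHom_frac]
  rfl

/-- The vector of values `(z_j/zᵢ)(κ)` has `i`-th entry `1`, so `xᵢ` does not vanish on it.
[folklore] -/
theorem aeval_evalAt_ne_zero {i : Fin (n + 1)} (hκ : ⊤ ≤ κ ⁻¹ᵁ lsChart z i) :
    aeval (fun j => evalAt κ (lsChart z i) hκ (lsRatio z i j)) (MvPolynomial.X i : MvPolynomial _ k) ≠ 0 := by
  rw [aeval_X, lsRatio_self, evalAt, map_one, map_one]
  exact one_ne_zero

/-- **Homogeneous coordinates of the image of an `L`-point**: for an `L`-valued point `κ` of `X`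
over `k` landing in the `i`-th chart of the linear system, `κ ≫ toProjOfVec z` is the `L`-point
of `ℙⁿ_k` with homogeneous coordinates `((z₀/zᵢ)(κ) : … : (zₙ/zᵢ)(κ))`
(`Motives.ProjectiveSpace.chartPoint`). [cite: Hartshorne1977, II Thm. 7.1 (proof)] -/
theorem comp_toProjOfVec_eq_chartPoint
    (hκf : κ ≫ f = Spec.map (CommRingCat.ofHom (algebraMap k L)))
    {i : Fin (n + 1)} (hκ : ⊤ ≤ κ ⁻¹ᵁ lsChart z i) :
    κ ≫ toProjOfVec z f hdef =
      (ProjectiveSpace.chartPoint (Segre.X_mem k i) one_pos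
        (fun j => evalAt κ (lsChart z i) hκ (lsRatio z i j)) (aeval_evalAt_ne_zero z κ hκ)).left := by
  rw [comp_toProjOfVec z f hdef κ hκ, ProjectiveSpace.chartPoint_left,
    GeneratingSections.chartMap]
  -- the ring maps agree: both are the evaluation `x_j/xᵢ ↦ (z_j/zᵢ)(κ)`
  set e := chartAlgHom z f hdef κ hκf hκ with he
  have hcoord : (fun j => e (ProjectiveSpace.coord i j)) =
      fun j => evalAt κ (lsChart z i) hκ (lsRatio z i j) :=
    funext fun j => chartAlgHom_coord z f hdef κ hκf hκ j
  have heval : ProjectiveSpace.awayEval (fun j => evalAt κ (lsChart z i) hκ (lsRatio z i j))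
      (aeval_evalAt_ne_zero z κ hκ) = e := by
    have h := ProjectiveSpace.awayEval_coord_eq i e
    simp only [hcoord] at h
    exact h
  rw [heval]
  have hring : CommRingCat.ofHom e.toRingHom =
      CommRingCat.ofHom ((linearSystem z hdef).chartRingHom f i κ hκ) ≫
        (Scheme.ΓSpecIso (.of L)).hom := rfl
  rw [hring, Spec.map_comp, Category.assoc, ← Category.assoc (Spec.map _),
    SpecMap_ΓSpecIso_hom]
  simp only [Category.assoc]

variable [Algebra k X.functionField]

omit [IsIntegral X] in
/-- `Spec` of the stalk at the generic point maps onto the generic point. [folklore] -/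
theorem fromSpecStalk_genericPoint_apply [IsIntegral X] (p : Spec X.functionField) :
    X.fromSpecStalk (genericPoint X) p = genericPoint X := by
  have hbot : ∀ q : PrimeSpectrum X.functionField, q.asIdeal = ⊥ := fun q => by
    rcases Ideal.eq_bot_or_top q.asIdeal with h | h
    · exact h
    · exact absurd h q.isPrime.ne_top
  have hp : p = IsLocalRing.closedPoint (X.functionField) :=
    PrimeSpectrum.ext ((hbot p).trans (hbot _).symm)
  rw [hp]
  exact X.fromSpecStalk_closedPoint

/-- The generic point lands in the `i`-th chart when `zᵢ ≠ 0`. [folklore] -/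
theorem top_le_fromSpecStalk_preimage_lsChart {i : Fin (n + 1)} (hi : z i ≠ 0) :
    ⊤ ≤ X.fromSpecStalk (genericPoint X) ⁻¹ᵁ lsChart z i := by
  intro p _
  show X.fromSpecStalk (genericPoint X) p ∈ lsChart z i
  rw [fromSpecStalk_genericPoint_apply]
  exact genericPoint_mem_lsChart z hi

/-- **The value at the generic point of the ratio section `z_j/zᵢ` is `z_j/zᵢ ∈ K(X)`.**
[folklore] -/
theorem evalAt_fromSpecStalk_lsRatio {i : Fin (n + 1)} (hi : z i ≠ 0) (j : Fin (n + 1)) :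
    evalAt (X.fromSpecStalk (genericPoint X)) (lsChart z i)
      (top_le_fromSpecStalk_preimage_lsChart z hi) (lsRatio z i j) = z j / z i := by
  rw [← ofSection_lsRatio z hi j]
  have hid : ∀ g : (op (⊤ : (Spec X.functionField).Opens)) ⟶ op ⊤,
      (Spec X.functionField).presheaf.map g = 𝟙 _ := fun g => by
    rw [Subsingleton.elim g (𝟙 _), CategoryTheory.Functor.map_id]
  have key : (X.fromSpecStalk (genericPoint X)).appLE (lsChart z i) ⊤
        (top_le_fromSpecStalk_preimage_lsChart z hi) ≫ (Scheme.ΓSpecIso X.functionField).hom =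
      X.presheaf.germ (lsChart z i) (genericPoint X) (genericPoint_mem_lsChart z hi) := by
    rw [Scheme.Hom.appLE, Scheme.fromSpecStalk_app (genericPoint_mem_lsChart z hi)]
    simp only [Category.assoc]
    rw [← CategoryTheory.Functor.map_comp_assoc, hid, Category.id_comp, Iso.inv_hom_id,
      Category.comp_id]
  exact congrArg (fun φ => φ.hom (lsRatio z i j)) key

/-- **The `K(X)`-point of `toProjOfVec z` is the point with homogeneous coordinates `z`**
(`Motives.ProjectiveSpace.pointOfVec`): the rational map defined by `z` is `(z₀ : … : zₙ)` at the
generic point. [cite: Hartshorne1977, II Thm. 7.1 (proof)] -/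
theorem fromSpecStalk_genericPoint_toProjOfVec
    (hgen : X.fromSpecStalk (genericPoint X) ≫ f =
      Spec.map (CommRingCat.ofHom (algebraMap k X.functionField))) (hz : z ≠ 0) :
    X.fromSpecStalk (genericPoint X) ≫ toProjOfVec z f hdef =
      (ProjectiveSpace.pointOfVec k z hz).left := by
  obtain ⟨i, hi⟩ : ∃ i, z i ≠ 0 := by
    by_contra h
    apply hz
    funext j
    by_contra hj
    exact h ⟨j, hj⟩
  have hκ := top_le_fromSpecStalk_preimage_lsChart z hi
  rw [comp_toProjOfVec_eq_chartPoint z f hdef (X.fromSpecStalk (genericPoint X)) hgen hκ]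
  have hw : (fun j => evalAt (X.fromSpecStalk (genericPoint X)) (lsChart z i) hκ (lsRatio z i j)) =
      (z i)⁻¹ • z := by
    funext j
    rw [evalAt_fromSpecStalk_lsRatio z hi j, Pi.smul_apply, smul_eq_mul, div_eq_inv_mul]
  have hzi : aeval z (MvPolynomial.X i : MvPolynomial _ k) ≠ 0 := by rwa [aeval_X]
  have hczi : aeval ((z i)⁻¹ • z) (MvPolynomial.X i : MvPolynomial _ k) ≠ 0 := by
    rw [aeval_X, Pi.smul_apply, smul_eq_mul, inv_mul_cancel₀ hi]
    exact one_ne_zero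
  have key : ProjectiveSpace.chartPoint (Segre.X_mem k i) one_pos
      (fun j => evalAt (X.fromSpecStalk (genericPoint X)) (lsChart z i) hκ (lsRatio z i j))
      (aeval_evalAt_ne_zero z _ hκ) =
      ProjectiveSpace.chartPoint (Segre.X_mem k i) one_pos ((z i)⁻¹ • z) hczi := by
    congr 1
  rw [key, ProjectiveSpace.chartPoint_smul _ _ z hzi _ (inv_ne_zero hi),
    ProjectiveSpace.pointOfVec_eq_chartPoint z hz (Segre.X_mem k i) one_pos hzi]

end Points

end Literature.AlgebraicGeometry.Resolution

end
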